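import Mathlib
import Literature.MathematicalPhysics.QuantumLattice.WilsonDiracAP
import Summits.QuantumFields.QCD.Theorems.QuarksAsStableActionCriticalLineDiamagnetismStubCellIncidence
import Summits.QuantumFields.QCD.Theorems.QuarksAsStableActionCriticalLineDiamagnetismStubCellRegauge
import Summits.QuantumFields.QCD.Theorems.WilsonQuarkChessboardFlatCellOptimalStubCellGaugeAllN
import Summits.QuantumFields.QCD.Theorems.WilsonQuarkChessboardFlatCellOptimalStubCellGainOfGaugedAllN
import Summits.QuantumFields.QCD.Theorems.WilsonQuarkChessboardFlatCellOptimalStubTilingCellDataAllN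

/-!
# Re-gauging glue, `N` colours, `K` tracked: the one-cell gain for good-gauge cells gives it for all
small-link cells
(helper for crux stmt-QuantumFields-9307 `FlatCellOptimal`, line `registered`, stub
`stub_localNormGain_of` (G4 transport), sub-goal `stub_cellRegaugeAllN` — the `Fin 3 ↦ Fin N`,
K-TRACKED port of the sibling crux stmt-QuantumFields-9734's `…CriticalLineDiamagnetismStubCellRegauge`,
wave 12)

What.  The step CellGainCore → CellRegauge of the all-`N` cell-gain chain, POINTWISE and with the
additive constant `K` and the rate `cg` EXPLICIT and UNCHANGED (`stub_cellRegaugeAllN`): there is an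
`N`-free constant `C_B ≥ 0` (`= max C 0`, `C = 1920` the constant of the landed `N`-generic cell gauge
`…FlatCellOptimal.CellGauge.stub_cellGaugeAllN`, G3) such that for every link threshold `η_g > 0` there
is `η > 0` (`= η_g / (528 (C_B + 1))`) with: for all `K cg : ℝ`, all `N`, all `M ≥ 2` (torus `(ℤ/2M)⁴`),
every mass `m`, the tiling `tile` given by its defining equation, every `U(N)` field `V` and corner `c`
whose `32` closed-cell links have deficit `N − Re tr V_e ≤ η` — IF the tiling-currency gain
`‖det D_AP[tile_c W]‖ ≤ exp(K − cg M⁴ S_cell(W)) ‖det D_AP[𝟙]‖` holds for every `W` whose cell links have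
deficit `≤ η_g` AND which is in a GOOD GAUGE, `F_cell(W) ≤ C_B · S_cell(W)` (total cell-link deficit
against total cell-plaquette deficit), THEN the same gain (same `K`, same `cg`) holds for `V`.  In the
crux `K = 0`: no additive slack is created by this step.  The glue at fixed data (`CellRegauge.glue`) is
stated in the four Finsets involved, which enter only through membership hypotheses.

How (the sibling's re-gauging, `3 ↦ N`).  By G3 (`L = 2M ≥ 4`) some gauge `g` makes
`F_cell(V^g) ≤ C Σ_{cell plaquettes} (N − Re tr V_p)`; the G3 `val`-filter of cell plaquettes is contained
in the items' `inCell` filter (`CellGainOfGauged.eq_of_val_sub_eq_zero`, …), so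
`F_cell(W) ≤ C_B S_cell(V) = C_B S_cell(W)` for `W := V^g` (plaquette traces are gauge invariant): `W` is
in a good gauge.  Its cell links are still small: a single cell-link deficit of `W` is at most
`F_cell(W) ≤ C_B S_cell(V)`, the cell has at most `24` plaquettes (`card_le_of_subset_cell`, `N`-free),
and each cell plaquette deficit is at most `8d₁ + 8d₂ + 4d₃ + 2d₄ ≤ 22 η` in terms of the deficits of its
four links, which are cell links (`N − Re tr(uv) ≤ 2(N − Re tr u) + 2(N − Re tr v)` on `U(N)`,
`deficit_mul_le`, iterated in `plaquette_deficit_le`; `Re tr u⁻¹ = Re tr u`,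
`…TilingData.TilingCellData.trace_re_inv`); so `S_cell(V) ≤ 528 η` and every cell link of `W` has
deficit `≤ C_B · 528 η ≤ η_g`.  The good-gauge gain for `W` is the gain for `V`: fold identity
`tile_c (V^g) = (tile_c V)^{g ∘ fold_c}` (even `L`, every `N`, landed
`…FlatCellOptimal.GaugeOrbit.tile_gaugeTransform`) and gauge invariance of the seam-twisted determinant
(`…GaugeOrbit.det_seam_gaugeTransform`).  The `N`-free cell bookkeeping of the sibling file
(`val_sub_le_one_of`, `links_of_inCell`) is re-EXPORTED into `…CellGain.CellRegauge` (aliases, no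
restatement).  References: K. G. Wilson, Phys. Rev. D 10 (1974) 2445 (gauge invariance); M. Creutz,
*Quarks, gluons and lattices* (1983) Ch. 9 (tree gauges); folklore trace inequality.  Pure theorem file
(no definitions).
-/

noncomputable section

open scoped BigOperators Classical Matrix ComplexConjugate ComplexOrder
open Finset
open Literature.MathematicalPhysics.QuantumLattice Literature.MathematicalPhysics.QuantumFieldTheory
  Literature.Probability.LatticeModels

namespace Summit.QuantumFields.QCD.Cruxes.FlatCellOptimal.CellGain

namespace CellRegauge

/-! ### `N`-free cell bookkeeping of the sibling file, re-exported -/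

export Summit.QuantumFields.QCD.Cruxes.CriticalLineDiamagnetism.ChessboardCellGain.CellRegauge
  (val_sub_le_one_of links_of_inCell)

variable {N : ℕ}

/-! ### Trace deficits on `U(N)` -/

/-- The trace inequality on `U(N)`: `N - Re tr (u v) ≤ 2 (N - Re tr u) + 2 (N - Re tr v)`
(`0 ≤ Re tr Zᴴ Z` for `Z = (1 - uᴴ) + (1 - v)`, i.e. `‖1 - uv‖_F² ≤ 2‖1 - u‖_F² + 2‖1 - v‖_F²`). -/
theorem deficit_mul_le (u v : Matrix.unitaryGroup (Fin N) ℂ) :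
    (N : ℝ) - (((u * v : Matrix.unitaryGroup (Fin N) ℂ)) : Matrix (Fin N) (Fin N) ℂ).trace.re ≤
      2 * ((N : ℝ) - ((u : Matrix (Fin N) (Fin N) ℂ)).trace.re) +
        2 * ((N : ℝ) - ((v : Matrix (Fin N) (Fin N) ℂ)).trace.re) := by
  -- adapted from the sibling `CellRegauge.deficit_mul_le` (`3 ↦ N`: `tr 1 = N`)
  rw [Matrix.UnitaryGroup.mul_val]
  set A : Matrix (Fin N) (Fin N) ℂ := u.1 with hA
  set B : Matrix (Fin N) (Fin N) ℂ := v.1 with hB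
  have hA' : A * Aᴴ = 1 := by
    simpa only [Matrix.star_eq_conjTranspose] using Matrix.mem_unitaryGroup_iff.mp u.2
  have hB' : Bᴴ * B = 1 := by
    simpa only [Matrix.star_eq_conjTranspose] using Matrix.mem_unitaryGroup_iff'.mp v.2
  have hpos : 0 ≤ (((1 - Aᴴ) + (1 - B))ᴴ * ((1 - Aᴴ) + (1 - B))).trace.re :=
    (Complex.nonneg_iff.mp (Matrix.posSemidef_conjTranspose_mul_self _).trace_nonneg).1
  have hexp : ((1 - Aᴴ) + (1 - B))ᴴ * ((1 - Aᴴ) + (1 - B)) =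
      (1 + 1 - A - Aᴴ) + (1 - A - B + A * B) + (1 - Aᴴ - Bᴴ + Bᴴ * Aᴴ) + (1 + 1 - B - Bᴴ) := by
    rw [Matrix.conjTranspose_add, Matrix.conjTranspose_sub, Matrix.conjTranspose_sub,
      Matrix.conjTranspose_one, Matrix.conjTranspose_conjTranspose]
    have e : ((1 : Matrix (Fin N) (Fin N) ℂ) - A + (1 - Bᴴ)) * (1 - Aᴴ + (1 - B)) =
        (1 + 1 - A - Aᴴ) + (1 - A - B + A * B) + (1 - Aᴴ - Bᴴ + Bᴴ * Aᴴ) + (1 + 1 - B - Bᴴ) +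
          (A * Aᴴ - 1) + (Bᴴ * B - 1) := by
      noncomm_ring
    rw [e, hA', hB', sub_self, add_zero, add_zero]
  have hre : ∀ X : Matrix (Fin N) (Fin N) ℂ, Xᴴ.trace.re = X.trace.re := fun X => by
    rw [Matrix.trace_conjTranspose, Complex.star_def, Complex.conj_re]
  have h3 : (Bᴴ * Aᴴ).trace.re = (A * B).trace.re := by
    rw [← Matrix.conjTranspose_mul, Matrix.trace_conjTranspose, Complex.star_def, Complex.conj_re]
  rw [hexp] at hpos
  simp only [Matrix.trace_add, Matrix.trace_sub, Matrix.trace_one, Fintype.card_fin,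
    Complex.natCast_re, Complex.add_re, Complex.sub_re, hre, h3] at hpos
  linarith

/-- **A plaquette deficit is controlled by the deficits of its four links** (`U(N)`):
`N - Re tr U_p ≤ 8 d₁ + 8 d₂ + 4 d₃ + 2 d₄` for `U_p = U₁ U₂ U₃⁻¹ U₄⁻¹` (iterate `deficit_mul_le`,
`Re tr u⁻¹ = Re tr u`). -/
theorem plaquette_deficit_le {L : ℕ} (U : GaugeConfig 4 L (Matrix.unitaryGroup (Fin N) ℂ))
    (x : Site 4 L) (μ ν : Fin 4) :
    (N : ℝ) - (((plaquetteHolonomy U x μ ν : Matrix.unitaryGroup (Fin N) ℂ)) :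
        Matrix (Fin N) (Fin N) ℂ).trace.re ≤
      8 * ((N : ℝ) - ((U (x, μ) : Matrix.unitaryGroup (Fin N) ℂ) : Matrix (Fin N) (Fin N) ℂ).trace.re) +
      8 * ((N : ℝ) - ((U (Site.shift x μ, ν) : Matrix.unitaryGroup (Fin N) ℂ) :
        Matrix (Fin N) (Fin N) ℂ).trace.re) +
      4 * ((N : ℝ) - ((U (Site.shift x ν, μ) : Matrix.unitaryGroup (Fin N) ℂ) :
        Matrix (Fin N) (Fin N) ℂ).trace.re) +
      2 * ((N : ℝ) - ((U (x, ν) : Matrix.unitaryGroup (Fin N) ℂ) : Matrix (Fin N) (Fin N) ℂ).trace.re) := by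
  -- adapted from the sibling `CellRegauge.plaquette_deficit_le` (`3 ↦ N`)
  have h1 := deficit_mul_le (U (x, μ) * U (Site.shift x μ, ν) * (U (Site.shift x ν, μ))⁻¹) (U (x, ν))⁻¹
  have h2 := deficit_mul_le (U (x, μ) * U (Site.shift x μ, ν)) (U (Site.shift x ν, μ))⁻¹
  have h3 := deficit_mul_le (U (x, μ)) (U (Site.shift x μ, ν))
  rw [TilingData.TilingCellData.trace_re_inv] at h1 h2
  unfold plaquetteHolonomy
  linarith

/-! ### The glue at fixed data (`K`, `cg` tracked) -/

/-- **The re-gauging glue at fixed `M`, every `N`, `K` tracked** (abstract in the items' `tile`, given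
by its defining equation, in the two cell Finsets `EF`, `PF` of the cell gauge, and in the two Finsets
`EF'` (cell links) and `CF` (cell plaquettes) of the items).  If `g` is a cell gauge for `V` at `c`
(`Σ_{EF} deficit(V^g) ≤ C Σ_{PF} deficit(V)`, `C ≤ C_B`, `0 ≤ C_B`), the cell links of `V` are `η`-small
with `C_B · 528 η ≤ η_g`, and the one-cell gain `‖det D_AP[tile_c W]‖ ≤ exp(K − cg M⁴ S_CF(W)) ‖det D_AP[𝟙]‖`
holds for every `W` with `η_g`-small cell links in a good gauge (`Σ_{EF'} deficit ≤ C_B Σ_{CF} deficit`),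
then it holds for `V` — the same `K` and `cg`. -/
theorem glue {M : ℕ} [NeZero M] {ηg η C CB cg K m : ℝ} (hη : 0 ≤ η) (hC : C ≤ CB) (hCB0 : 0 ≤ CB)
    (hth : CB * (528 * η) ≤ ηg)
    {tile : Site 4 (2 * M) → GaugeConfig 4 (2 * M) (Matrix.unitaryGroup (Fin N) ℂ) →
      GaugeConfig 4 (2 * M) (Matrix.unitaryGroup (Fin N) ℂ)}
    (htile : ∀ (c : Site 4 (2 * M)) (V : GaugeConfig 4 (2 * M) (Matrix.unitaryGroup (Fin N) ℂ))
      (e : Edge 4 (2 * M)), tile c V e = if (e.1 e.2 - c e.2).val % 2 = 0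
        then V (fun ν => c ν + (((e.1 ν - c ν).val % 2 : ℕ) : ZMod (2 * M)), e.2)
        else (V (fun ν => c ν + (((Site.shift e.1 e.2 ν - c ν).val % 2 : ℕ) : ZMod (2 * M)), e.2))⁻¹)
    (V : GaugeConfig 4 (2 * M) (Matrix.unitaryGroup (Fin N) ℂ)) (c : Site 4 (2 * M))
    (hlinks : ∀ e : Edge 4 (2 * M), ((∀ ν, (e.1 ν - c ν).val ≤ 1) ∧ (e.1 e.2 - c e.2).val = 0) →
      (N : ℝ) - ((V e : Matrix.unitaryGroup (Fin N) ℂ) : Matrix (Fin N) (Fin N) ℂ).trace.re ≤ η)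
    (g : Site 4 (2 * M) → Matrix.unitaryGroup (Fin N) ℂ)
    {EF EF' : Finset (Edge 4 (2 * M))} {PF CF : Finset (Plaquette 4 (2 * M))}
    (hg : (∑ e ∈ EF, ((N : ℝ) - (((gaugeTransform g V e : Matrix.unitaryGroup (Fin N) ℂ) :
        Matrix (Fin N) (Fin N) ℂ)).trace.re)) ≤
      C * ∑ p ∈ PF, ((N : ℝ) - (((plaquetteHolonomy V p.1 p.2.1.1 p.2.1.2 :
        Matrix.unitaryGroup (Fin N) ℂ) : Matrix (Fin N) (Fin N) ℂ)).trace.re))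
    (hEF : ∀ e : Edge 4 (2 * M), ((∀ ν, (e.1 ν - c ν).val ≤ 1) ∧ (e.1 e.2 - c e.2).val = 0) → e ∈ EF)
    (hEF' : ∀ e ∈ EF', (∀ ν, (e.1 ν - c ν).val ≤ 1) ∧ (e.1 e.2 - c e.2).val = 0)
    (hPF : ∀ p ∈ PF, (∀ ν, (p.1 ν - c ν).val ≤ 1) ∧ (p.1 p.2.1.1 - c p.2.1.1).val = 0 ∧
      (p.1 p.2.1.2 - c p.2.1.2).val = 0)
    (hCF : ∀ p : Plaquette 4 (2 * M), (p.1 p.2.1.1 = c p.2.1.1 ∧ p.1 p.2.1.2 = c p.2.1.2 ∧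
      ∀ ν, ν ≠ p.2.1.1 → ν ≠ p.2.1.2 → (p.1 ν = c ν ∨ p.1 ν = c ν + 1)) → p ∈ CF)
    (hG : ∀ W : GaugeConfig 4 (2 * M) (Matrix.unitaryGroup (Fin N) ℂ),
      (∀ e : Edge 4 (2 * M), ((∀ ν, (e.1 ν - c ν).val ≤ 1) ∧ (e.1 e.2 - c e.2).val = 0) →
        (N : ℝ) - ((W e : Matrix.unitaryGroup (Fin N) ℂ) : Matrix (Fin N) (Fin N) ℂ).trace.re ≤ ηg) →
      (∑ e ∈ EF', ((N : ℝ) - ((W e : Matrix.unitaryGroup (Fin N) ℂ) :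
          Matrix (Fin N) (Fin N) ℂ).trace.re)) ≤
        CB * ∑ p ∈ CF, ((N : ℝ) - (unitaryFundamentalRep (Fin N) ℂ
          (plaquetteHolonomy W p.1 p.2.1.1 p.2.1.2)).trace.re) →
      ‖(wilsonDirac (unitaryFundamentalRep (Fin N) ℂ)
          (fun e => if (e.1 e.2).val + 1 = 2 * M then -(tile c W e) else tile c W e) m 1).det‖ ≤
        Real.exp (K - cg * (M : ℝ) ^ 4 * ∑ p ∈ CF, ((N : ℝ) - (unitaryFundamentalRep (Fin N) ℂ
          (plaquetteHolonomy W p.1 p.2.1.1 p.2.1.2)).trace.re)) *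
          ‖(wilsonDirac (unitaryFundamentalRep (Fin N) ℂ)
              (fun e : Edge 4 (2 * M) => if (e.1 e.2).val + 1 = 2 * M then
                (-1 : Matrix.unitaryGroup (Fin N) ℂ) else 1) m 1).det‖) :
    ‖(wilsonDirac (unitaryFundamentalRep (Fin N) ℂ)
        (fun e => if (e.1 e.2).val + 1 = 2 * M then -(tile c V e) else tile c V e) m 1).det‖ ≤
      Real.exp (K - cg * (M : ℝ) ^ 4 * ∑ p ∈ CF, ((N : ℝ) - (unitaryFundamentalRep (Fin N) ℂ
        (plaquetteHolonomy V p.1 p.2.1.1 p.2.1.2)).trace.re)) *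
        ‖(wilsonDirac (unitaryFundamentalRep (Fin N) ℂ)
            (fun e : Edge 4 (2 * M) => if (e.1 e.2).val + 1 = 2 * M then
              (-1 : Matrix.unitaryGroup (Fin N) ℂ) else 1) m 1).det‖ := by
  -- adapted from the sibling `CellRegauge.glue` (`3 ↦ N`, `max C_B 0 ↦ C ≤ C_B, 0 ≤ C_B`)
  -- (1) the plaquettes of `PF` lie in the closed cell: at most `24` of them, each of deficit `≤ 22 η`
  have hPFcell : ∀ p ∈ PF, p.1 p.2.1.1 = c p.2.1.1 ∧ p.1 p.2.1.2 = c p.2.1.2 ∧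
      ∀ κ, κ ≠ p.2.1.1 → κ ≠ p.2.1.2 → (p.1 κ = c κ ∨ p.1 κ = c κ + 1) := fun p hp => by
    obtain ⟨h1, h2, h3⟩ := hPF p hp
    exact ⟨CellGainOfGauged.eq_of_val_sub_eq_zero h2, CellGainOfGauged.eq_of_val_sub_eq_zero h3,
      fun κ _ _ => CellGainOfGauged.eq_or_eq_add_one_of_val_sub_le_one (h1 κ)⟩
  have hcard : PF.card ≤ 24 := CellGainOfGauged.card_le_of_subset_cell c PF hPFcell
  have hplaq : ∀ p ∈ PF, (N : ℝ) - (((plaquetteHolonomy V p.1 p.2.1.1 p.2.1.2 :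
      Matrix.unitaryGroup (Fin N) ℂ) : Matrix (Fin N) (Fin N) ℂ)).trace.re ≤ 22 * η := by
    intro p hp
    obtain ⟨h1, h2, h3⟩ := hPFcell p hp
    obtain ⟨l1, l2, l3, l4⟩ := links_of_inCell (ne_of_lt p.2.2) h1 h2 h3
    have d1 := hlinks (p.1, p.2.1.1) l1
    have d2 := hlinks (Site.shift p.1 p.2.1.1, p.2.1.2) l2
    have d3 := hlinks (Site.shift p.1 p.2.1.2, p.2.1.1) l3
    have d4 := hlinks (p.1, p.2.1.2) l4
    have h0 := plaquette_deficit_le V p.1 p.2.1.1 p.2.1.2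
    linarith
  have hS0 : 0 ≤ ∑ p ∈ PF, ((N : ℝ) - (((plaquetteHolonomy V p.1 p.2.1.1 p.2.1.2 :
      Matrix.unitaryGroup (Fin N) ℂ) : Matrix (Fin N) (Fin N) ℂ)).trace.re) :=
    Finset.sum_nonneg fun p _ => CellGainOfGauged.deficit_nonneg _
  have hSle : ∑ p ∈ PF, ((N : ℝ) - (((plaquetteHolonomy V p.1 p.2.1.1 p.2.1.2 :
      Matrix.unitaryGroup (Fin N) ℂ) : Matrix (Fin N) (Fin N) ℂ)).trace.re) ≤ 528 * η :=
    calc ∑ p ∈ PF, ((N : ℝ) - (((plaquetteHolonomy V p.1 p.2.1.1 p.2.1.2 :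
          Matrix.unitaryGroup (Fin N) ℂ) : Matrix (Fin N) (Fin N) ℂ)).trace.re)
        ≤ ∑ _p ∈ PF, 22 * η := Finset.sum_le_sum hplaq
      _ = PF.card * (22 * η) := by rw [Finset.sum_const, nsmul_eq_mul]
      _ ≤ 24 * (22 * η) :=
          mul_le_mul_of_nonneg_right (by exact_mod_cast hcard) (mul_nonneg (by norm_num) hη)
      _ = 528 * η := by ring
  -- (2) in the cell gauge every cell link of `W := V^g` has deficit at most `ηg`
  have hFW : ∑ e ∈ EF, ((N : ℝ) - (((gaugeTransform g V e : Matrix.unitaryGroup (Fin N) ℂ) :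
      Matrix (Fin N) (Fin N) ℂ)).trace.re) ≤
      CB * ∑ p ∈ PF, ((N : ℝ) - (((plaquetteHolonomy V p.1 p.2.1.1 p.2.1.2 :
        Matrix.unitaryGroup (Fin N) ℂ) : Matrix (Fin N) (Fin N) ℂ)).trace.re) :=
    hg.trans (mul_le_mul_of_nonneg_right hC hS0)
  have hlinksW : ∀ e : Edge 4 (2 * M), ((∀ ν, (e.1 ν - c ν).val ≤ 1) ∧ (e.1 e.2 - c e.2).val = 0) →
      (N : ℝ) - ((gaugeTransform g V e : Matrix.unitaryGroup (Fin N) ℂ) :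
        Matrix (Fin N) (Fin N) ℂ).trace.re ≤ ηg := by
    intro e he
    have h1 := Finset.single_le_sum (f := fun e : Edge 4 (2 * M) =>
        (N : ℝ) - (((gaugeTransform g V e : Matrix.unitaryGroup (Fin N) ℂ) :
          Matrix (Fin N) (Fin N) ℂ)).trace.re) (fun e _ => CellGainOfGauged.deficit_nonneg _) (hEF e he)
    exact h1.trans (hFW.trans ((mul_le_mul_of_nonneg_left hSle hCB0).trans hth))
  -- (3) `W` is in a good gauge: `EF' ⊆ EF`, `PF ⊆ CF`, and `S_cell` is gauge invariant
  have hsumCF : ∀ U : GaugeConfig 4 (2 * M) (Matrix.unitaryGroup (Fin N) ℂ),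
      ∑ p ∈ CF, ((N : ℝ) - (unitaryFundamentalRep (Fin N) ℂ
        (plaquetteHolonomy (gaugeTransform g U) p.1 p.2.1.1 p.2.1.2)).trace.re) =
      ∑ p ∈ CF, ((N : ℝ) - (unitaryFundamentalRep (Fin N) ℂ
        (plaquetteHolonomy U p.1 p.2.1.1 p.2.1.2)).trace.re) := fun U =>
    Finset.sum_congr rfl fun p _ => by
      rw [CellGainOfGauged.trace_plaquetteHolonomy_gaugeTransform]
  have hEFsub : EF' ⊆ EF := fun e he => hEF e (hEF' e he)
  have hPFsub : PF ⊆ CF := fun p hp => hCF p (hPFcell p hp)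
  have hPC : ∑ p ∈ PF, ((N : ℝ) - (((plaquetteHolonomy V p.1 p.2.1.1 p.2.1.2 :
      Matrix.unitaryGroup (Fin N) ℂ) : Matrix (Fin N) (Fin N) ℂ)).trace.re) ≤
      ∑ p ∈ CF, ((N : ℝ) - (unitaryFundamentalRep (Fin N) ℂ
        (plaquetteHolonomy V p.1 p.2.1.1 p.2.1.2)).trace.re) := by
    simp only [unitaryFundamentalRep_apply]
    exact Finset.sum_le_sum_of_subset_of_nonneg hPFsub fun p _ _ => CellGainOfGauged.deficit_nonneg _
  have hgauge : ∑ e ∈ EF', ((N : ℝ) - ((gaugeTransform g V e : Matrix.unitaryGroup (Fin N) ℂ) :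
      Matrix (Fin N) (Fin N) ℂ).trace.re) ≤
      CB * ∑ p ∈ CF, ((N : ℝ) - (unitaryFundamentalRep (Fin N) ℂ
        (plaquetteHolonomy (gaugeTransform g V) p.1 p.2.1.1 p.2.1.2)).trace.re) := by
    rw [hsumCF V]
    exact ((Finset.sum_le_sum_of_subset_of_nonneg hEFsub
      fun e _ _ => CellGainOfGauged.deficit_nonneg _).trans hFW).trans
        (mul_le_mul_of_nonneg_left hPC hCB0)
  -- (4) the good-gauge gain for `W`, transported back to `V`
  have key := hG (gaugeTransform g V) hlinksW hgauge
  rw [hsumCF V, CellGainOfGauged.tile_gaugeTransform (even_two_mul M) htile g V c,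
    CellGainOfGauged.det_seam_gaugeTransform] at key
  exact key

/-- The threshold arithmetic: `C_B · 528 · (η_g / (528 (C_B + 1))) ≤ η_g` for `C_B ≥ 0`, `η_g ≥ 0`. -/
theorem threshold_le {CB ηg : ℝ} (hCB : 0 ≤ CB) (hηg : 0 ≤ ηg) :
    CB * (528 * (ηg / (528 * (CB + 1)))) ≤ ηg := by
  have hC : (0 : ℝ) < 528 * (CB + 1) := by positivity
  have hkey : ηg / (528 * (CB + 1)) * (528 * (CB + 1)) = ηg := div_mul_cancel₀ ηg hC.ne'
  nlinarith [div_nonneg hηg hC.le]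

end CellRegauge

/-- **Sub-goal `stub_cellRegaugeAllN` (G4 port, wave 12) — `cellRegauge` for `Fin N`, pointwise, `K`
tracked.**  There is an `N`-free `C_B ≥ 0` (the regauge constant: `max C 0` for the constant `C` of the
`N`-generic cell gauge G3) such that for every `η_g > 0` there is `η > 0` (`= η_g / (528 (C_B + 1))`)
with: for all `K cg : ℝ`, all `N`, all `M ≥ 2`, every mass `m`, the tiling `tile` given by its defining
equation, every `U(N)` field `V` on `(ℤ/2M)⁴` and corner `c` with `η`-small closed-cell links — if the
tiling-currency gain `‖det D_AP[tile_c W]‖ ≤ exp(K − cg M⁴ S_cell(W)) ‖det D_AP[𝟙]‖` holds for every `W`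
with `η_g`-small cell links in a good gauge (`F_cell(W) ≤ C_B · S_cell(W)`), then it holds for `V`,
with the SAME `K` and `cg`. -/
theorem stub_cellRegaugeAllN : ∃ CB : ℝ, 0 ≤ CB ∧ ∀ (ηg : ℝ), 0 < ηg → ∃ η : ℝ, 0 < η ∧ ∀ (K cg : ℝ) (N M : ℕ) [NeZero M], 2 ≤ M → ∀ (m : ℝ) (tile : Site 4 (2 * M) → GaugeConfig 4 (2 * M) (Matrix.unitaryGroup (Fin N) ℂ) → GaugeConfig 4 (2 * M) (Matrix.unitaryGroup (Fin N) ℂ)), (∀ (c : Site 4 (2 * M)) (V : GaugeConfig 4 (2 * M) (Matrix.unitaryGroup (Fin N) ℂ)) (e : Edge 4 (2 * M)), tile c V e = if (e.1 e.2 - c e.2).val % 2 = 0 then V (fun ν => c ν + (((e.1 ν - c ν).val % 2 : ℕ) : ZMod (2 * M)), e.2) else (V (fun ν => c ν + (((Site.shift e.1 e.2 ν - c ν).val % 2 : ℕ) : ZMod (2 * M)), e.2))⁻¹) → ∀ (V : GaugeConfig 4 (2 * M) (Matrix.unitaryGroup (Fin N) ℂ)) (c : Site 4 (2 * M)), (∀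 e : Edge 4 (2 * M), ((∀ ν, (e.1 ν - c ν).val ≤ 1) ∧ (e.1 e.2 - c e.2).val = 0) → (N : ℝ) - ((V e : Matrix.unitaryGroup (Fin N) ℂ) : Matrix (Fin N) (Fin N) ℂ).trace.re ≤ η) → (∀ W : GaugeConfig 4 (2 * M) (Matrix.unitaryGroup (Fin N) ℂ), (∀ e : Edge 4 (2 * M), ((∀ ν, (e.1 ν - c ν).val ≤ 1) ∧ (e.1 e.2 - c e.2).val = 0) → (N : ℝ) - ((W e : Matrix.unitaryGroup (Fin N) ℂ) : Matrix (Fin N) (Fin N) ℂ).trace.re ≤ ηg) → (∑ e ∈ Finset.univ.filter (fun e : Edge 4 (2 * M) => (∀ ν, (e.1 ν - c ν).val ≤ 1) ∧ (e.1 e.2 - c e.2).val = 0), ((N : ℝ) - ((W e : Matrix.unitaryGroup (Fin N) ℂ) : Matrix (Fin N) (Fin N) ℂ).trace.re)) ≤ CB * ∑ p ∈ Finset.univ.filter (fun p : Plaquette 4 (2 * M) => p.1 p.2.1.1 = c p.2.1.1 ∧ p.1 p.2.1.2 = c p.2.1.2 ∧ ∀ ν, ν ≠ p.2.1.1 → ν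 ≠ p.2.1.2 → (p.1 ν = c ν ∨ p.1 ν = c ν + 1)), ((N : ℝ) - (unitaryFundamentalRep (Fin N) ℂ (plaquetteHolonomy W p.1 p.2.1.1 p.2.1.2)).trace.re) → ‖(wilsonDirac (unitaryFundamentalRep (Fin N) ℂ) (fun e => if (e.1 e.2).val + 1 = 2 * M then -(tile c W e) else tile c W e) m 1).det‖ ≤ Real.exp (K - cg * (M : ℝ) ^ 4 * ∑ p ∈ Finset.univ.filter (fun p : Plaquette 4 (2 * M) => p.1 p.2.1.1 = c p.2.1.1 ∧ p.1 p.2.1.2 = c p.2.1.2 ∧ ∀ ν, ν ≠ p.2.1.1 → ν ≠ p.2.1.2 → (p.1 ν = c ν ∨ p.1 ν = c ν + 1)), ((N : ℝ) - (unitaryFundamentalRep (Fin N) ℂ (plaquetteHolonomy W p.1 p.2.1.1 p.2.1.2)).trace.re)) * ‖(wilsonDirac (unitaryFundamentalRep (Fin N) ℂ) (fun e : Edge 4 (2 * M) => if (e.1 e.2).val + 1 = 2 * M then (-1 : Matrix.unitaryGroup (Fin N) ℂ) else 1) m 1).det‖) → ‖(wilsonDirac (unitaryFundamentalRep (Fin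 N) ℂ) (fun e => if (e.1 e.2).val + 1 = 2 * M then -(tile c V e) else tile c V e) m 1).det‖ ≤ Real.exp (K - cg * (M : ℝ) ^ 4 * ∑ p ∈ Finset.univ.filter (fun p : Plaquette 4 (2 * M) => p.1 p.2.1.1 = c p.2.1.1 ∧ p.1 p.2.1.2 = c p.2.1.2 ∧ ∀ ν, ν ≠ p.2.1.1 → ν ≠ p.2.1.2 → (p.1 ν = c ν ∨ p.1 ν = c ν + 1)), ((N : ℝ) - (unitaryFundamentalRep (Fin N) ℂ (plaquetteHolonomy V p.1 p.2.1.1 p.2.1.2)).trace.re)) * ‖(wilsonDirac (unitaryFundamentalRep (Fin N) ℂ) (fun e : Edge 4 (2 * M) => if (e.1 e.2).val + 1 = 2 * M then (-1 : Matrix.unitaryGroup (Fin N) ℂ) else 1) m 1).det‖ := by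
  obtain ⟨C, hC⟩ := Summit.QuantumFields.QCD.Cruxes.FlatCellOptimal.CellGauge.stub_cellGaugeAllN
  refine ⟨max C 0, le_max_right _ _, ?_⟩
  intro ηg hηg
  have hpos : (0 : ℝ) < 528 * (max C 0 + 1) := by positivity
  refine ⟨ηg / (528 * (max C 0 + 1)), div_pos hηg hpos, ?_⟩
  intro K cg N M _ hM m tile htile V c hlinks hG
  obtain ⟨g, hg⟩ := hC N (2 * M) (by omega) V c
  refine CellRegauge.glue (m := m) (div_pos hηg hpos).le (le_max_left C 0) (le_max_right C 0)
    (CellRegauge.threshold_le (le_max_right C 0) hηg.le) htile V c hlinks g hg ?_ ?_ ?_ ?_ hG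
  · exact fun e he => CellGainOfGauged.mem_filter_univ_of he
  · exact fun e he => (CellGainOfGauged.of_mem_filter_univ he :)
  · exact fun p hp => (CellGainOfGauged.of_mem_filter_univ hp :)
  · exact fun p hp => CellGainOfGauged.mem_filter_univ_of hp

end Summit.QuantumFields.QCD.Cruxes.FlatCellOptimal.CellGain

end
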